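import Summits.ABC.IUTFork.Repair.ObstructionSS28Window
import HarnessLib

/-!
# R-H ROUND 2 row 27 «reach-ledger» — the (β)-end door: a CELL-SLACK MINORANT with nonnegative procession average gives the Statement

PROOF-ONLY support piece (0 definitions, 0 `Prop` facts; abc-iut cell, D-0079 RESCUE sub-cell R-H, rung LADDER-ABC:A2.RESCUE.H; pair n = 10
typer abc-iut-rh-typ-10, support-by-name for rh2-L1's (β) bookkeeping per ROUND2/START-HERE §2). TAKES NO SIDE on [IUTchIII] Cor. 3.12 or on
any author; typed ≠ proved; nothing here asserts abc proved or refuted.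

WHAT. abc-iut-rp-s2's `Repair.ObstructionSS28Window.statement_iff_avg_cellSlack` reads the typed Corollary as `0 ≤ PN(i ↦ Σᶠ_{v_ℚ} σ_{i+1,v_ℚ})`
with the cell slack `σ = logvol(ⁿ˒°𝒰) − qLocal` (spelled out), and `statement_of_cellSlack_nonneg` is the all-cells-nonnegative end. Row 27's
route (door (b)) supplies instead a per-cell MINORANT `L(i, v_ℚ) ≤ σ_{i+1,v_ℚ}` (abc-iut-rh-typ-10's L1 `RH.ReachLedgerVolume.levels_le_cellSlack`:
`L = log p · Σ Pr·⌊s/e⌋` at the bad packets, `0` elsewhere) whose procession average is nonnegative once the per-place ledger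
`RH.ReachLedger.LedgerCell` is regrouped by place ((β), rh2-L1's lane). This file is the one-line door between the two:
`statement_of_cellSlack_minorant` — minorant `L ≤ σ` cellwise, `L` finitely supported per label, `0 ≤ PN(Σᶠ L)` ⟹ `Statement` (`ThetaFinite`).
[cite: Mochizuki2012, IUTchIII Cor. 3.12 p. 173–174; Rmk. 3.9.3 pp. 119–120] [claim: Mochizuki2012, status: disputed]
-/

noncomputable section

open Set

namespace Summit.ABC.IUTFork.Repair.RH.ReachLedgerBudget

open Thm311 Cor312 Cor312Vol Literature.IUT.LogThetaLattice Summit.ABC.IUTFork.Repair.ObstructionSS28Window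

variable {T : ThetaIndex} (S : LatticeSituation T) (P : Cor312.Setting S.toSituation)

/-- **MINORANT BUDGET ⟹ STATEMENT.** For every setting with `ThetaFinite`: if `L(i, v_ℚ) ≤ σ_{i+1,v_ℚ} = logvol(ⁿ˒°𝒰_{i+1,v_ℚ}) − qLocal_{i+1,v_ℚ}`
at every cell, each `L(i, ·)` is finitely supported, and `0 ≤ PN(i ↦ Σᶠ_{v_ℚ} L(i, v_ℚ))`, then the typed [IUTchIII] Cor. 3.12 `Statement` holds
(`statement_iff_avg_cellSlack` + monotonicity of `Σᶠ` and of the procession average). With `L = 0` this is abc-iut-rp-s2's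
`statement_of_cellSlack_nonneg`. [claim: Mochizuki2012, status: disputed] -/
theorem statement_of_cellSlack_minorant (hfin : P.ThetaFinite) (L : Fin T.lstar → T.VQ → ℝ)
    (hsupp : ∀ i : Fin T.lstar, (Function.support (L i)).Finite)
    (hL : ∀ (i : Fin T.lstar) (vQ : T.VQ),
      L i vQ ≤ (S.D P.n).logvol _ vQ (P.thetaHull (Setting.labelSucc i) vQ) - P.qLocal (Setting.labelSucc i) vQ)
    (hsum : 0 ≤ processionNormalized (fun i : Fin T.lstar => ∑ᶠ vQ : T.VQ, L i vQ)) :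
    P.Statement := by
  rw [statement_iff_avg_cellSlack S P hfin]
  exact hsum.trans (processionNormalized_mono fun i =>
    finsum_le_finsum' (hsupp i) (cellSlack_support_finite S P hfin i) fun vQ => hL i vQ)

/-- **… supported on a finite set of cells.** Same, with the minorant given only on a finite set `W` of rational places per label (`L := 0`
off `W`, where `σ ≥ 0` is then required — e.g. the volume licence at good / archimedean packets) and the budget a finite sum.
[claim: Mochizuki2012, status: disputed] -/
theorem statement_of_cellSlack_minorant_on (hfin : P.ThetaFinite) (W : Fin T.lstar → Finset T.VQ) (L : Fin T.lstar → T.VQ → ℝ)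
    (hL : ∀ (i : Fin T.lstar) (vQ : T.VQ), vQ ∈ W i →
      L i vQ ≤ (S.D P.n).logvol _ vQ (P.thetaHull (Setting.labelSucc i) vQ) - P.qLocal (Setting.labelSucc i) vQ)
    (hoff : ∀ (i : Fin T.lstar) (vQ : T.VQ), vQ ∉ W i →
      0 ≤ (S.D P.n).logvol _ vQ (P.thetaHull (Setting.labelSucc i) vQ) - P.qLocal (Setting.labelSucc i) vQ)
    (hsum : 0 ≤ processionNormalized (fun i : Fin T.lstar => ∑ vQ ∈ W i, L i vQ)) :
    P.Statement := by
  classical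
  refine statement_of_cellSlack_minorant S P hfin (fun i vQ => if vQ ∈ W i then L i vQ else 0) (fun i => ?_) (fun i vQ => ?_) ?_
  · exact (W i).finite_toSet.subset fun vQ hvQ => by
      by_contra h
      exact hvQ (if_neg h)
  · by_cases h : vQ ∈ W i
    · rw [if_pos h]; exact hL i vQ h
    · rw [if_neg h]; exact hoff i vQ h
  · refine hsum.trans_eq (congrArg processionNormalized (funext fun i => ?_))
    rw [finsum_eq_sum_of_support_subset _ (s := W i)]
    · exact Finset.sum_congr rfl fun vQ hvQ => (if_pos hvQ).symm
    · intro vQ hvQ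
      by_contra h
      exact hvQ (if_neg h)

end Summit.ABC.IUTFork.Repair.RH.ReachLedgerBudget

end
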